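import Summits.NavierStokesRegularity.FunctionalMining.StretchingLaminateStatP
import HarnessLib

/-!
# K1-Q1 laminate step, part 8: the ENSTROPHY statistic `∫ ½|G + ∇curl A|²` of the laminate potential

Cell `pub-nsfunc` (host summit NavierStokesRegularity, topic `FunctionalMining`), prove seat gen 6, for the
`LaminateStep` node (dict BLUEPRINT §3, `statE`). **Search for candidate a priori estimates; no regularity claim.**
Static smooth fields on `T³`.

`abs_statE_sub_le`: `|∫ halfSqM(G + ∇curl A) − (λ ∫halfSqM(G₊ + X₊) + (1−λ) ∫halfSqM(G₋ + X₋))| ≤ 9ρ(β_Z+ρ) + Στ + ε·C₁ᴱ`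
with the four two-scale errors `τ` as hypotheses and the explicit `C₁ᴱ = statEConst β_G β_M β_X`.
-/

noncomputable section

open MeasureTheory Set Filter Topology Function
open scoped ContDiff

namespace Summit.NavierStokesRegularity.FunctionalMining

open Literature.Analysis Literature.Analysis.FunctionSpaces Literature.Analysis.FunctionSpaces.Torus
open Literature.Analysis.FluidPDE Literature.Analysis.FluidPDE.Torus
open LaminateWindow LaminateDirection WrapStretching Confinement Laminate

namespace LamData

/-! ## 1. The real bookkeeping -/

/-- **Combination of the enstrophy estimates** (pure real arithmetic). [ours; bookkeeping] -/
theorem statE_combine {IT IZ IY i1 i2 j1 j2 aP2 aM2 HP HM pYp pYm pGp pGm SP SM lam ε e1 e3 e4 τ1 τ2 σ1 σ2 bH : ℝ}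
    (hlam : 0 < lam) (hlam1 : lam < 1)
    (H1 : |IT - IZ| ≤ e1) (H2 : IZ = IY + (i1 + i2) + (j1 + j2))
    (H3 : |IY - (lam * pYp + (1 - lam) * pYm)| ≤ e3)
    (H4p : |pYp - pGp| ≤ e4) (H4m : |pYm - pGm| ≤ e4)
    (H5 : |i1| ≤ τ1) (H6 : |i2 - aP2 * HP| ≤ τ2) (H5' : |j1| ≤ σ1) (H6' : |j2 - aM2 * HM| ≤ σ2)
    (hHP : |HP| ≤ bH) (hHM : |HM| ≤ bH)
    (ha2 : |aP2 - lam| ≤ 4 * ε) (ha2' : |aM2 - (1 - lam)| ≤ 4 * ε)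
    (HSP : SP = pGp + HP) (HSM : SM = pGm + HM) :
    |IT - (lam * SP + (1 - lam) * SM)| ≤ e1 + e3 + e4 + (τ1 + τ2 + σ1 + σ2) + 2 * (4 * ε * bH) := by
  have hbH : 0 ≤ bH := (abs_nonneg _).trans hHP
  have P1 : |(aP2 - lam) * HP| ≤ 4 * ε * bH := by
    rw [abs_mul]; exact mul_le_mul ha2 hHP (abs_nonneg _) (by linarith [abs_nonneg (aP2 - lam)])
  have P3 : |(aM2 - (1 - lam)) * HM| ≤ 4 * ε * bH := by
    rw [abs_mul]; exact mul_le_mul ha2' hHM (abs_nonneg _) (by linarith [abs_nonneg (aP2 - lam)])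
  have P7 : |lam * (pYp - pGp)| ≤ lam * e4 := by
    rw [abs_mul, abs_of_pos hlam]; exact mul_le_mul_of_nonneg_left H4p hlam.le
  have P8 : |(1 - lam) * (pYm - pGm)| ≤ (1 - lam) * e4 := by
    rw [abs_mul, abs_of_pos (by linarith)]; exact mul_le_mul_of_nonneg_left H4m (by linarith)
  have e : IT - (lam * SP + (1 - lam) * SM) =
      (IT - IZ) + (IY - (lam * pYp + (1 - lam) * pYm)) + lam * (pYp - pGp) + (1 - lam) * (pYm - pGm) +
      i1 + ((i2 - aP2 * HP) + (aP2 - lam) * HP) + j1 + ((j2 - aM2 * HM) + (aM2 - (1 - lam)) * HM) := by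
    rw [H2, HSP, HSM]; ring
  rw [e, abs_le]
  obtain ⟨a1, b1⟩ := abs_le.1 H1
  obtain ⟨a3, b3⟩ := abs_le.1 H3
  obtain ⟨a5, b5⟩ := abs_le.1 H5
  obtain ⟨a6, b6⟩ := abs_le.1 H6
  obtain ⟨a8, b8⟩ := abs_le.1 H5'
  obtain ⟨a9, b9⟩ := abs_le.1 H6'
  obtain ⟨c1, d1⟩ := abs_le.1 P1
  obtain ⟨c3, d3⟩ := abs_le.1 P3
  obtain ⟨c7, d7⟩ := abs_le.1 P7
  obtain ⟨c8, d8⟩ := abs_le.1 P8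
  constructor <;> linarith

/-- The `ε`-coefficient of the enstrophy error (depends on the sup bounds only). [ours; bookkeeping] -/
def statEConst (βG βM βX : ℝ) : ℝ := 18 * (βG + βM) ^ 2 + 18 * βM * (βG + 2 * βM) + 36 * βX ^ 2

/-- The `ε`-terms of the enstrophy error are dominated by `ε · statEConst`. [ours; bookkeeping] -/
theorem statE_eps_terms_le {βG βM βX ε : ℝ} (hβM : 0 ≤ βM) (hε : 0 ≤ ε) (hε4 : ε ≤ 1 / 4) :
    4 * ε * (9 / 2 * (βG + βM) ^ 2) + 9 * (2 * ε * βM) * ((βG + βM) + 2 * ε * βM) +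
      2 * (4 * ε * (9 / 2 * βX ^ 2)) ≤ ε * statEConst βG βM βX := by
  have h2 : 9 * (2 * ε * βM) * ((βG + βM) + 2 * ε * βM) ≤ 9 * (2 * ε * βM) * (βG + 2 * βM) :=
    mul_le_mul_of_nonneg_left (by nlinarith) (by positivity)
  calc _ ≤ 4 * ε * (9 / 2 * (βG + βM) ^ 2) + 9 * (2 * ε * βM) * (βG + 2 * βM) + 2 * (4 * ε * (9 / 2 * βX ^ 2)) := by
        linarith
    _ = ε * statEConst βG βM βX := by unfold statEConst; ring

variable (D : LamData)

section StatE

variable {G : Fin 3 → Fin 3 → ℝ} {βG βM βX ρp ρm : ℝ} {m : ℕ}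
variable (hβG : ∀ i j, |G i j| ≤ βG) (hβM : ∀ i j, |D.M i j| ≤ βM)
  (hβXp : ∀ y i j, |D.XP y i j| ≤ βX) (hβXm : ∀ y i j, |D.XM y i j| ≤ βX)
  (hRp : ∀ x i j, |gradAt (curlField (D.BP m)) x i j - D.EP x * D.XP (m • x) i j| ≤ ρp)
  (hRm : ∀ x i j, |gradAt (curlField (D.BM m)) x i j - D.EM x * D.XM (m • x) i j| ≤ ρm)

/-! ## 2. The pieces -/

/-- `∫ halfSqM(Y + X(y)) dy = halfSqM Y + ∫ halfSqM X` when the entries of `X = ∇curl A` have mean zero. [ours] -/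
theorem integral_halfSqM_add_gradAt {A : UnitAddTorus (Fin 3) → EuclideanSpace ℝ (Fin 3)} (hA : IsSmooth A)
    (Y : Fin 3 → Fin 3 → ℝ) :
    ∫ y, halfSqM (Y + gradAt (curlField A) y) = halfSqM Y + ∫ y, halfSqM (gradAt (curlField A) y) := by
  have hF := isSmooth_curlField hA
  have h1 : Integrable (fun y => frob Y (gradAt (curlField A) y)) := (isSmooth_frob_gradAt hF Y).integrable
  have h2 : Integrable (fun y => halfSqM (gradAt (curlField A) y)) := (isSmooth_halfSqM_gradAt hF).integrable
  have h12 : Integrable (fun y => frob Y (gradAt (curlField A) y) + halfSqM (gradAt (curlField A) y)) := h1.add h2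
  have h0 : ∫ y, frob Y (gradAt (curlField A) y) = 0 :=
    integral_frob_eq_zero Y (integrable_gradAt_curlField hA) (integral_gradAt_curlField_eq_zero hA)
  simp_rw [halfSqM_add']
  rw [integral_add (integrable_const _) h12, integral_add h1 h2, h0, zero_add]
  simp

/-- Target expansion for the `+` child. [ours; bookkeeping] -/
theorem integral_halfSqM_Gp (G : Fin 3 → Fin 3 → ℝ) :
    ∫ y, halfSqM (D.Gp G + D.XP y) = halfSqM (D.Gp G) + ∫ y, halfSqM (D.XP y) :=
  integral_halfSqM_add_gradAt D.hAp _

/-- Target expansion for the `−` child. [ours; bookkeeping] -/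
theorem integral_halfSqM_Gm (G : Fin 3 → Fin 3 → ℝ) :
    ∫ y, halfSqM (D.Gm G + D.XM y) = halfSqM (D.Gm G) + ∫ y, halfSqM (D.XM y) :=
  integral_halfSqM_add_gradAt D.hAm _

/-- **The plateau expansion of the enstrophy density, integrated.** [ours] -/
theorem integral_halfSqM_Z_eq (G : Fin 3 → Fin 3 → ℝ) (m : ℕ) :
    ∫ x, halfSqM (D.Z G m x) = (∫ x, halfSqM (G + D.slope x • D.M)) +
      ((∫ x, D.EP x * frob (D.Yp G) (D.XP (m • x))) + ∫ x, D.EP x ^ 2 * halfSqM (D.XP (m • x))) +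
      ((∫ x, D.EM x * frob (D.Ym G) (D.XM (m • x))) + ∫ x, D.EM x ^ 2 * halfSqM (D.XM (m • x))) := by
  have hFp := isSmooth_curlField D.hAp
  have hFm := isSmooth_curlField D.hAm
  have hcY : Continuous fun x => halfSqM (G + D.slope x • D.M) := continuous_halfSqM (D.continuous_lam_apply G)
  have hcP := (D.isSmooth_EP).continuous
  have hcM := (D.isSmooth_EM).continuous
  have hc1 : Continuous fun x => D.EP x * frob (D.Yp G) (D.XP (m • x)) :=
    hcP.mul ((isSmooth_frob_gradAt hFp _).continuous.comp (continuous_nsmul m))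
  have hc2 : Continuous fun x => D.EP x ^ 2 * halfSqM (D.XP (m • x)) :=
    (hcP.pow 2).mul ((isSmooth_halfSqM_gradAt hFp).continuous.comp (continuous_nsmul m))
  have hd1 : Continuous fun x => D.EM x * frob (D.Ym G) (D.XM (m • x)) :=
    hcM.mul ((isSmooth_frob_gradAt hFm _).continuous.comp (continuous_nsmul m))
  have hd2 : Continuous fun x => D.EM x ^ 2 * halfSqM (D.XM (m • x)) :=
    (hcM.pow 2).mul ((isSmooth_halfSqM_gradAt hFm).continuous.comp (continuous_nsmul m))
  have i12 : Integrable (fun x => D.EP x * frob (D.Yp G) (D.XP (m • x)) + D.EP x ^ 2 * halfSqM (D.XP (m • x))) :=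
    (hc1.add hc2).integrable_unitAddTorus
  have j12 : Integrable (fun x => D.EM x * frob (D.Ym G) (D.XM (m • x)) + D.EM x ^ 2 * halfSqM (D.XM (m • x))) :=
    (hd1.add hd2).integrable_unitAddTorus
  have iY12 : Integrable (fun x => halfSqM (G + D.slope x • D.M) +
      (D.EP x * frob (D.Yp G) (D.XP (m • x)) + D.EP x ^ 2 * halfSqM (D.XP (m • x)))) :=
    (hcY.add (hc1.add hc2)).integrable_unitAddTorus
  simp_rw [D.halfSqM_Z_eq]
  rw [integral_add iY12 j12, integral_add hcY.integrable_unitAddTorus i12,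
    integral_add hc1.integrable_unitAddTorus hc2.integrable_unitAddTorus,
    integral_add hd1.integrable_unitAddTorus hd2.integrable_unitAddTorus]

include hβG hβM in
/-- **The laminate part is two-valued up to `4εK_E`**, `K_E = (9/2)(β_G + β_M)²`. [ours] -/
theorem abs_integral_lam_halfSqM_sub_le :
    |(∫ x, halfSqM (G + D.slope x • D.M)) - (D.q.lam * halfSqM (D.Yp G) + (1 - D.q.lam) * halfSqM (D.Ym G))| ≤
      4 * D.q.eps * (9 / 2 * (βG + βM) ^ 2) := by
  have hK : ∀ s ∈ Icc (0 : ℝ) 1, |halfSqM (G + (s - D.q.mu) • D.M)| ≤ 9 / 2 * (βG + βM) ^ 2 := fun s hs => by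
    have hμ := D.q.mu_bounds
    refine abs_halfSqM_le (abs_add_smul_entry_le hβG hβM ?_)
    rw [abs_le]; constructor <;> linarith [hs.1, hs.2, D.q.mu_pos, D.q.lam_lt_one]
  have hQc : Continuous fun s : ℝ => halfSqM (G + (s - D.q.mu) • D.M) :=
    continuous_halfSqM fun i j => by
      simp only [Pi.add_apply, Pi.smul_apply, smul_eq_mul]; fun_prop
  have h := D.abs_integral_comp_slope_sub_le hQc hK
  have e1 : ∀ x, G + (D.slope x + D.q.mu - D.q.mu) • D.M = G + D.slope x • D.M := fun x => by rw [add_sub_cancel_right]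
  simp only [e1, zero_sub] at h
  exact h

include hβG hβM in
/-- `|halfSqM Y₊ − halfSqM G₊| ≤ 18εβ_M(β_G + β_M + 2εβ_M)`. [ours] -/
theorem abs_halfSqM_Yp_sub_le : |halfSqM (D.Yp G) - halfSqM (D.Gp G)| ≤ 9 * (2 * D.q.eps * βM) * ((βG + βM) + 2 * D.q.eps * βM) :=
  abs_halfSqM_sub_le (D.abs_Gp_le hβG hβM) fun i j => by
    have h := D.abs_Yp_sub_Gp_le (G := G) hβM i j; rwa [one_mul] at h

include hβG hβM in
/-- `|halfSqM Y₋ − halfSqM G₋| ≤ 18εβ_M(β_G + β_M + 2εβ_M)`. [ours] -/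
theorem abs_halfSqM_Ym_sub_le : |halfSqM (D.Ym G) - halfSqM (D.Gm G)| ≤ 9 * (2 * D.q.eps * βM) * ((βG + βM) + 2 * D.q.eps * βM) :=
  abs_halfSqM_sub_le (D.abs_Gm_le hβG hβM) fun i j => by
    have h := D.abs_Ym_sub_Gm_le (G := G) hβM i j; rwa [one_mul] at h

include hβXp in
/-- `|∫ halfSqM X₊| ≤ (9/2)β_X²`. [ours; bookkeeping] -/
theorem abs_HP_le : |∫ y, halfSqM (D.XP y)| ≤ 9 / 2 * βX ^ 2 :=
  abs_integral_le_of_pointwise (isSmooth_halfSqM_gradAt (isSmooth_curlField D.hAp)).continuous fun y => abs_halfSqM_le (hβXp y)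

include hβXm in
/-- `|∫ halfSqM X₋| ≤ (9/2)β_X²`. [ours; bookkeeping] -/
theorem abs_HM_le : |∫ y, halfSqM (D.XM y)| ≤ 9 / 2 * βX ^ 2 :=
  abs_integral_le_of_pointwise (isSmooth_halfSqM_gradAt (isSmooth_curlField D.hAm)).continuous fun y => abs_halfSqM_le (hβXm y)

/-! ## 3. The enstrophy estimate -/

include hβG hβM hβXp hβXm hRp hRm in
/-- **THE ENSTROPHY STATISTIC OF THE LAMINATE STEP.** Given the four two-scale errors at the scale `m`,
`|∫ halfSqM(G + ∇curl A) − (λ·∫halfSqM(G₊ + X₊) + (1−λ)·∫halfSqM(G₋ + X₋))| ≤ 9ρ(β_Z+ρ) + Στ + ε·C₁ᴱ`. [ours] -/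
theorem abs_statE_sub_le {τP1 τP2 τM1 τM2 : ℝ}
    (hτP1 : |(∫ x, D.EP x * frob (D.Yp G) (D.XP (m • x))) - (∫ x, D.EP x) * ∫ y, frob (D.Yp G) (D.XP y)| ≤ τP1)
    (hτP2 : |(∫ x, D.EP x ^ 2 * halfSqM (D.XP (m • x))) - (∫ x, D.EP x ^ 2) * ∫ y, halfSqM (D.XP y)| ≤ τP2)
    (hτM1 : |(∫ x, D.EM x * frob (D.Ym G) (D.XM (m • x))) - (∫ x, D.EM x) * ∫ y, frob (D.Ym G) (D.XM y)| ≤ τM1)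
    (hτM2 : |(∫ x, D.EM x ^ 2 * halfSqM (D.XM (m • x))) - (∫ x, D.EM x ^ 2) * ∫ y, halfSqM (D.XM y)| ≤ τM2) :
    |(∫ x, halfSqM (D.T G m x)) -
        (D.q.lam * (∫ y, halfSqM (D.Gp G + D.XP y)) + (1 - D.q.lam) * ∫ y, halfSqM (D.Gm G + D.XM y))| ≤
      9 * (ρp + ρm) * ((βG + βM + 2 * βX) + (ρp + ρm)) + (τP1 + τP2 + τM1 + τM2) + D.q.eps * statEConst βG βM βX := by
  have hε := D.q.heps
  have hε4 : D.q.eps ≤ 1 / 4 := by linarith [D.q.h4p, D.q.lam_lt_one]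
  have hβM0 : 0 ≤ βM := (abs_nonneg _).trans (hβM 0 0)
  have hJP1 : ∫ y, frob (D.Yp G) (D.XP y) = 0 :=
    integral_frob_eq_zero _ (integrable_gradAt_curlField D.hAp) (integral_gradAt_curlField_eq_zero D.hAp)
  have hJM1 : ∫ y, frob (D.Ym G) (D.XM y) = 0 :=
    integral_frob_eq_zero _ (integrable_gradAt_curlField D.hAm) (integral_gradAt_curlField_eq_zero D.hAm)
  rw [hJP1, mul_zero, sub_zero] at hτP1
  rw [hJM1, mul_zero, sub_zero] at hτM1
  have H1 : |(∫ x, halfSqM (D.T G m x)) - ∫ x, halfSqM (D.Z G m x)| ≤ 9 * (ρp + ρm) * ((βG + βM + 2 * βX) + (ρp + ρm)) :=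
    abs_integral_sub_le_of_pointwise (continuous_halfSqM (D.continuous_T_apply G m))
      (continuous_halfSqM (D.continuous_Z_apply G m)) fun x => D.abs_halfSqM_T_sub_le hβG hβM hβXp hβXm hRp hRm x
  have h := statE_combine D.q.lam_pos D.q.lam_lt_one H1 (D.integral_halfSqM_Z_eq G m)
    (D.abs_integral_lam_halfSqM_sub_le hβG hβM) (D.abs_halfSqM_Yp_sub_le hβG hβM) (D.abs_halfSqM_Ym_sub_le hβG hβM)
    hτP1 hτP2 hτM1 hτM2 (D.abs_HP_le hβXp) (D.abs_HM_le hβXm)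
    (D.abs_integral_EP_pow_sub_le (by norm_num)) (D.abs_integral_EM_pow_sub_le (by norm_num))
    (D.integral_halfSqM_Gp G) (D.integral_halfSqM_Gm G)
  have hdom := statE_eps_terms_le (βG := βG) (βX := βX) hβM0 hε.le hε4
  linarith

end StatE

end LamData

end Summit.NavierStokesRegularity.FunctionalMining

end
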